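import Summits.QuantumFields.YangMills.Theorems.FlatTubeReductionDecimationTranslate
import Literature.MathematicalPhysics.QuantumFieldTheory.StrongCouplingActivities
import HarnessLib

/-!
# Route `FlatTubeReduction`, crux `PinnedUnitStepEx` (stmt-QuantumFields-27561), stub `stub_smearVarPosGS1` — E2b: gauge invariance of the
# Hoeffding parts and the one-site gauge step

Seat ym-line-fcl-p3 g9 (2026-08-28).  Blueprint v2 §Simplification.  For a gauge-invariant bounded measurable `g` on `GaugeConfig 3 M G`:
* `esPart_gaugeTransform` — every Hoeffding part is gauge invariant POINTWISE: `g^{=R}(U^k) = g^{=R}(U)` (the gauge action is coordinatewise by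
  two-sided Haar translations; `Hoeffding.esPart_comp_coordwise`);
* `esPart_eq_of_eqOn` — `g^{=R}` only sees the links in `R`;
* `esPart_eq_of_gauge_eqOn` — hence `g^{=R}(W) = g^{=R}(W′)` as soon as `W` agrees with a gauge transform of `W′` on `R`.
This is the mechanism by which all same-run decoder terms of the fine identity (★) coincide (one-site gauge transformations move the merge
position along a contractible run).  R2b1 RECORD rung; no summit/crux/stub here.
-/

set_option autoImplicit false

noncomputable section

namespace Summit.QuantumFields.YangMills.Theorems.FlatTubeReduction.Decimation

open MeasureTheory Finset Function
open Literature.MathematicalPhysics.QuantumFieldTheory (Site Edge GaugeConfig gaugeTransform haarProbability)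
open Literature.Probability.Independence.Hoeffding

variable {G : Type*} [Group G] [TopologicalSpace G] [IsTopologicalGroup G] [CompactSpace G] [MeasurableSpace G] [BorelSpace G]
variable {M : ℕ}

omit [TopologicalSpace G] [IsTopologicalGroup G] [CompactSpace G] [MeasurableSpace G] [BorelSpace G] in
/-- The gauge action is coordinatewise: link `e` is moved by `w ↦ k(e.1) · w · k(e.1 + e_{e.2})⁻¹`. [folklore] -/
theorem gaugeTransform_eq_coordwise (k : Site 3 M → G) (U : GaugeConfig 3 M G) :
    gaugeTransform k U = fun e => (fun (e : Edge 3 M) (w : G) => k e.1 * w * (k (e.1.shift e.2))⁻¹) e (U e) := rfl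

/-- Each coordinate map of the gauge action preserves the Haar probability measure (left and right translation). [folklore] -/
theorem measurePreserving_gauge_coord (k : Site 3 M → G) (e : Edge 3 M) :
    MeasurePreserving (fun w : G => k e.1 * w * (k (e.1.shift e.2))⁻¹) (haarProbability G) (haarProbability G) :=
  (measurePreserving_mul_right (haarProbability G) (k (e.1.shift e.2))⁻¹).comp (measurePreserving_mul_left (haarProbability G) (k e.1))

/-- ★ **Hoeffding parts of a gauge-invariant observable are gauge invariant, pointwise.** [folklore] -/
theorem esPart_gaugeTransform [Fintype (Edge 3 M)] {g : GaugeConfig 3 M G → ℝ} (hg : Measurable g)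
    (hGI : ∀ (k : Site 3 M → G) (U : GaugeConfig 3 M G), g (gaugeTransform k U) = g U)
    (R : Finset (Edge 3 M)) (k : Site 3 M → G) (U : GaugeConfig 3 M G) :
    esPart (haarProbability G) R g (gaugeTransform k U) = esPart (haarProbability G) R g U := by
  have h := esPart_comp_coordwise (μ := haarProbability G) (f := g)
    (φ := fun (e : Edge 3 M) (w : G) => k e.1 * w * (k (e.1.shift e.2))⁻¹) (measurePreserving_gauge_coord k) hg R U
  have hginv : (fun z : GaugeConfig 3 M G => g (fun e => k e.1 * z e * (k (e.1.shift e.2))⁻¹)) = g := by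
    funext z; exact hGI k z
  rw [hginv] at h
  exact h.symm

/-- `g^{=R}` only sees the links in `R`. [folklore] -/
theorem esPart_eq_of_eqOn [Fintype (Edge 3 M)] (g : GaugeConfig 3 M G → ℝ) (R : Finset (Edge 3 M)) {W W' : GaugeConfig 3 M G}
    (h : ∀ e ∈ R, W e = W' e) : esPart (haarProbability G) R g W = esPart (haarProbability G) R g W' :=
  dependsOff_esPart (μ := haarProbability G) R g W W' fun e he => h e (by
    by_contra hR; exact he (Finset.mem_sdiff.2 ⟨Finset.mem_univ _, hR⟩))

/-- ★ **Gauge step**: if `W` agrees on `R` with a gauge transform of `W′`, then `g^{=R}(W) = g^{=R}(W′)`. [folklore] -/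
theorem esPart_eq_of_gauge_eqOn [Fintype (Edge 3 M)] {g : GaugeConfig 3 M G → ℝ} (hg : Measurable g)
    (hGI : ∀ (k : Site 3 M → G) (U : GaugeConfig 3 M G), g (gaugeTransform k U) = g U)
    (R : Finset (Edge 3 M)) (k : Site 3 M → G) {W W' : GaugeConfig 3 M G} (h : ∀ e ∈ R, W e = gaugeTransform k W' e) :
    esPart (haarProbability G) R g W = esPart (haarProbability G) R g W' := by
  rw [esPart_eq_of_eqOn g R h, esPart_gaugeTransform hg hGI]

end Summit.QuantumFields.YangMills.Theorems.FlatTubeReduction.Decimation
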